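import Summits.QuantumAdvantage.QuantumAdvantage.Theses.LinnikCubicClassGroups
import Literature.Computability.Cryptography.HallgrenShiftParams
import Literature.Computability.Complexity.CodeFPStrings

/-!
# Crux `LinnikCubicClassGroups.PureCubicClassGroupFBQP` (stmt-QuantumAdvantage-11544) — the shift-sampling bundle of the class-group stage

Line `arakelov-giant-step-cycle`, stub `stub_classStageAssembly` (S5b-ASM), helper: the parameter bundle of the ONE
Fourier-sampling experiment of the class-group stage (the landed `stub_cubicSSParams` has too few units and too coarse an
accuracy for the exact-modes post-processing, which pairs `2n = nU` units and needs ALL of them read accurately):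

* `nU n = 1600 (n + 4)²` units (`800 (n+4)²` pairs beat the union bound over the `≤ (B+1)^(log₂ B + 2)` subgroups of the
  dual group, `log₂ B ≤ 20 n + 70`),
* block length `L n = (n + 1)²` (`Q = 2^L`; the assembly pads the input so that `L` covers the layout),
* levels `Lv n = L n + 1`, repetitions `B n = 2^26 (L n + 1) (n + 4)²`,

all positive and monotone, with counter expressions (`GEParams`), the four unary `CodeFP` facts, and the accuracy defect
`ηacc (Lv n) (B n) = 1 / (2^19 (n + 4)²)` — so that `nU · ηacc = 1600 / 2^19 < 1/64`. Adapted from the landed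
`…StubCubicSSParams.lean` / `Literature/Computability/Cryptography/HallgrenShiftParams.lean`; the structures are built inside
the proof.
-/

-- the problem namespace repeats the summit name (`QuantumAdvantage.QuantumAdvantage`)
set_option linter.dupNamespace false

namespace Summit.QuantumAdvantage.QuantumAdvantage.Theorems.LinnikCubicClassGroups

open Literature.Computability.Complexity (CodeFP GExpr)
open Literature.Computability.Complexity.CodeFP (unE pairE unitE fst snd unSucc unMulConst ulength unitsMul replicateUnit)
open Literature.Computability.Cryptography (ShiftSampling.SSParams)
open Literature.Computability.Cryptography.PeriodFinding (ηacc)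
open Literature.Computability.QuantumComplexity.RevSim (GE)

/-- The accuracy defect of the bundle: `2 (m + 1) · 64 / (2^26 (m + 1) (n + 4)²) = 1 / (2^19 (n + 4)²)` (here `m = (n + 1)²`). -/
theorem ηacc_classStage (n : ℕ) :
    ηacc ((n + 1) ^ 2 + 1) (2 ^ 26 * ((n + 1) ^ 2 + 1) * (n + 4) ^ 2) = 1 / (2 ^ 19 * (n + 4) ^ 2) := by
  unfold ηacc
  have h1 : (((n : ℝ) + 1) ^ 2 + 1) ≠ 0 := by positivity
  have h2 : ((n : ℝ) + 4) ≠ 0 := by positivity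
  push_cast
  field_simp
  ring

/-- **S5b-ASM `classStage_ssParams`**: the shift-sampling bundle of the class-group stage — `nU = 1600 (n+4)²` units,
block length `L = (n+1)²`, levels `Lv = L + 1`, repetitions `B = 2^26 (L + 1)(n + 4)²` (positive, monotone), their counter
expressions, their unary `CodeFP` facts, and the accuracy defect `ηacc(Lv, B) = 1/(2^19 (n+4)²)`. -/
theorem classStage_ssParams :
    ∃ (P : ShiftSampling.SSParams) (_Γ : P.GEParams),
      (∀ n, P.nU n = 1600 * (n + 4) ^ 2) ∧ (∀ n, P.L n = (n + 1) ^ 2) ∧ (∀ n, P.Lv n = (n + 1) ^ 2 + 1) ∧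
      (∀ n, P.B n = 2 ^ 26 * ((n + 1) ^ 2 + 1) * (n + 4) ^ 2) ∧
      CodeFP unE unE P.nU ∧ CodeFP unE unE P.L ∧ CodeFP unE unE P.Lv ∧ CodeFP unE unE P.B ∧
      ∀ n, ηacc (P.Lv n) (P.B n) = 1 / (2 ^ 19 * (n + 4) ^ 2) := by
  -- unary multiplication on codes: `(1ᵃ, 1ᵇ) ↦ 1^{ab}`
  have unMul : CodeFP (pairE unE unE) unE (fun p => p.1 * p.2) :=
    ((ulength unitE).comp (unitsMul.comp ((replicateUnit.comp (fst _ _)).pair (replicateUnit.comp (snd _ _))))).congr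
      fun p => by simp
  -- `n + 4` in unary
  have un4 : CodeFP unE unE (fun n => n + 4) := ((unSucc.comp (unSucc.comp (unSucc.comp unSucc))) :).congr fun n => by omega
  -- the four unary `CodeFP` facts, bottom-up
  have hS4 : CodeFP unE unE (fun n => (n + 4) ^ 2) := (unMul.comp (un4.pair un4)).congr fun n => by ring
  have hnU : CodeFP unE unE (fun n => 1600 * (n + 4) ^ 2) := ((unMulConst 1600).comp hS4 :)
  have hL : CodeFP unE unE (fun n => (n + 1) ^ 2) := (unMul.comp (unSucc.pair unSucc)).congr fun n => by ring
  have hLv : CodeFP unE unE (fun n => (n + 1) ^ 2 + 1) := (unSucc.comp hL :)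
  have hB : CodeFP unE unE (fun n => 2 ^ 26 * ((n + 1) ^ 2 + 1) * (n + 4) ^ 2) :=
    ((unMulConst (2 ^ 26)).comp (unMul.comp (hLv.pair hS4))).congr fun n => by ring
  -- the counter expressions
  let sE : GE := .add (.var .uu) (.const 1)
  let s4E : GE := .add (.var .uu) (.const 4)
  let lE : GE := .mul sE sE
  let lvE : GE := .add lE (.const 1)
  refine ⟨⟨fun n => 1600 * (n + 4) ^ 2, fun n => (n + 1) ^ 2, fun n => (n + 1) ^ 2 + 1,
      fun n => 2 ^ 26 * ((n + 1) ^ 2 + 1) * (n + 4) ^ 2,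
      fun n => by positivity, fun n => by positivity, fun n => Nat.succ_pos _, fun n => by positivity,
      fun a b h => by dsimp only; gcongr, fun a b h => by dsimp only; gcongr,
      fun a b h => by dsimp only; gcongr, fun a b h => by dsimp only; gcongr⟩,
    ⟨.mul (.const 1600) (.mul s4E s4E), lE, lvE, .mul (.mul (.const (2 ^ 26)) lvE) (.mul s4E s4E),
      fun env => ?_, fun env => ?_, fun env => ?_, fun env => ?_,
      fun x hx => ?_, fun x hx => ?_, fun x hx => ?_, fun x hx => ?_⟩,
    fun _ => rfl, fun _ => rfl, fun _ => rfl, fun _ => rfl, hnU, hL, hLv, hB, fun n => ηacc_classStage n⟩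
  · simp only [s4E, GExpr.eval]; ring
  · simp only [lE, sE, GExpr.eval]; ring
  · simp only [lvE, lE, sE, GExpr.eval]; ring
  · simp only [lvE, lE, sE, s4E, GExpr.eval]; ring
  · simpa [s4E, GExpr.fv] using hx
  · simpa [lE, sE, GExpr.fv] using hx
  · simpa [lvE, lE, sE, GExpr.fv] using hx
  · simpa [lvE, lE, sE, s4E, GExpr.fv] using hx

end Summit.QuantumAdvantage.QuantumAdvantage.Theorems.LinnikCubicClassGroups
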